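import Summits.BirchSwinnertonDyer.BirchSwinnertonDyer.Theorems.QuadraticBranchSignedControlPlusKatoDivisibilityOfColemanPackages
import Literature.NumberTheory.EllipticCurves.Kato2004.FineSelmerDualTorsionOfEulerSystemBoundProofs
import Literature.NumberTheory.EllipticCurves.Kato2004.ConditionVOfNotHasCMProofs
import Literature.NumberTheory.EllipticCurves.SupersingularIrreducibleProofs
import Summits.BirchSwinnertonDyer.BirchSwinnertonDyer.Theorems.QuadraticBranchSignedControlPlusKatoDivisibilityConditionVReach
import HarnessLib

/-!
# K8 crux 20445 / aside 21377 — lane B (g7), part 3: Kobayashi Thm. 1.2 and the Kato half (RK⁺) on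
# EVERY NON-CM Gss2 row from the CONSTRUCTION-level facts `{hZ, hCK, h134, h5}` — g3's tower-onto road
# (`ColemanKatoTorsion.…_onto`, Kato Thm. 13.4 (3) + (12.5.2)) re-run through Thm. 13.4 (2) at `(T)`,
# which needs Kato's (v) only, a theorem for every non-CM curve (proofs only)

Cell `bsd-potss` (HOME `run/shared/lean/pub/bsd-potss/`), seat `bsd-potss-k8q-c2x` g7 (prover; WIDTH-LEVER
lane B of the K8 Kato side, route `QuadraticBranchSignedControl`; crux stmt-BirchSwinnertonDyer-20445
`PlusKatoDivisibilityBranchOnto` (held aliases 21362 = hZ, 21363 = h134, 21364 = h12), aside 21377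
`PlusKatoDivisibilityBranch`, crux 19606 `PlusEtaMainConjectureNonsurj` (its non-CM rows)). HONEST FRAMING:
BSD is not proved by any of this; every theorem below is CONDITIONAL on the named Literature facts displayed
as hypotheses — `hZ = Kobayashi2003.thm62_63_73_etaColemanPoitouTate_zeta` (Coleman/Poitou–Tate package at
`η` with Euler-system pin), `hCK = Kobayashi2003.thm62_63_73_signedColemanKato_zeta` (the `η = 1` twin, cell
bsd-ssimc), `h134 = Kato2004.thm13_4_lengthAt_fineSelmerDual_le_of_isEulerSystemClass` (Kato Thm. 13.4),
`h5 = realPeriodRat_eq_unit_mul_plusPeriod` (period unit); no item closes; nothing is booked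
(`--supports 20445 --as helper`). PARTITION (D-0054): EXCLUDED-DOMAIN non-CM ∪ CM additive `p` · B4 Gss2
(`e = 2`, `p ≥ 5`); reach of this file = the NON-CM rows (tower onto or not).

## What is proved

* §1 `ColemanKatoTorsion.finite_isTorsion_of_colemanKato_of_thm13_4_of_conditionV` — Kobayashi Thm. 1.2
  (= Thm. 7.3 ii): every dual datum of `Sel^ε(V/ℚ_∞)` is finitely generated `Λ`-torsion) IN THE KERNEL
  from a datum `K : SignedColemanKatoData V p f ϖ κ γ ε I`, Kato Thm. 13.4 and Kato's hypothesis **(v)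
  ONLY** (`dim Coker(σ − 1 | T_pV) = 1` for some `σ` fixing `μ_{p^∞}`) — g3's
  `finite_isTorsion_of_colemanKato_of_thm13_4` asked instead for Thm. 13.4 (3)'s frame (`V[p]` irreducible
  ∧ `∃σ` with `Coker` FREE of rank one, i.e. (12.5.2)); the `X₀`-torsion step now goes through clause (2)
  at the prime `(T)` (Literature theorem `Kato2004.isTorsion_fineSelmerDual_of_thm13_4_of_injective`, same
  seat, p573337). `V[p]` irreducible is still used — only for the package's image clause
  (`image_zeta_localized`) — and is AUTOMATIC at a good supersingular odd `p` (Serre 1972 §1.11, tree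
  theorem `hasIrreducibleModPGaloisRep_of_dvd_frobeniusTrace`).
* §2 `finite_isTorsion_signedSelmerDual_of_colemanKato_nonCM` — **Thm. 1.2's conclusion for EVERY
  globally minimal NON-CM `V/ℚ`, `p ≥ 5` good with `a_p = 0`, every sign and dual datum, from
  `{hCK, h134, h5}`** ((v) by `Kato2004.exists_finrank_coker_eq_one_of_not_hasCM`, seat g5). Contains g3's
  tower-onto theorem (onto ⟹ non-CM, `KatoSideCM.not_hasCM_of_forall_hasSurjectiveModNGaloisRep`, g6).
* §3 `quadraticBranchPlusKatoDivisibilityAt_of_colemanPackages_of_not_hasCM` — **(RK⁺) on every non-CM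
  Gss2 row from `{hZ, hCK, h134, h5}`** (g3's `…_of_row` with §2 as the Thm. 1.2 input and (v) for
  `V^{(p*)}` from `exists_finrank_coker_eq_one_quadraticTwist_primeStar_of_not_hasCM`); hence
  `plusKatoDivisibilityBranch_nonCM_of_colemanPackages` — the aside decl `PlusKatoDivisibilityBranch`
  (item 21377) RESTRICTED to non-CM rows, and `plusKatoDivisibilityBranchOnto_of_colemanPackages'` — the
  crux decl 20445 (route decl BY NAME) from the same four facts (g3 had it: re-derived here through §2 as a
  one-line check that the non-CM road specialises to the crux).

## Census line (for the planner / referee)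

After this file, on EVERY NON-CM Gss2 row (the exact reach of Kato Thm. 13.4, g5/g6): (RK⁺) ⟸
`{hZ, hCK, h134, h5}` — two Coleman/Poitou–Tate CONSTRUCTION packages with Euler-system pins (`η`, `1`),
Kato's reduction-free Euler-system bound, the period unit — and NO Kobayashi THEOREM (1.2 / 2.2 / 4.1 /
Cor. 7.2) and NO Kato 12.4 / 12.2.2 / 17.13.1 cite is a hypothesis there. Before g7 this held on the
tower-onto rows only (g3); the non-onto non-CM rows (crux 19606's non-CM population) used `h12` (g5
`KatoSideNonCM.quadraticBranchPlusKatoDivisibilityAt_of_facts_of_not_hasCM`). The trust base BY NAME of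
20445 is unchanged (`{hZ, h134, h12}`); the swap `h12 ↔ {hCK, h5}` is offered, not applied. CM rows:
untouched (Kato (v) fails; lane A's road).

References: [Kobayashi2003] Thm. 1.2 (p. 2), Thm. 4.1 (p. 8), Thm. 6.3 (p. 11), Cor. 7.2, Thm. 7.3 (p. 13);
[Kato2004Asterisque] Thm. 12.4 (p. 221), Thm. 13.4 (p. 226) and the remark after it; [Serre1972] §1.11
Prop. 12; [GreenbergVatsal2000] §3 Rem. 3.4.
-/

noncomputable section

set_option linter.dupNamespace false

open scoped Classical

open CongruenceSubgroup Field WeierstrassCurve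
open Literature.NumberTheory.EllipticCurves
open Literature.NumberTheory.EllipticCurves.ModularForms
open Literature.NumberTheory.EllipticCurves.Rank1Residual
open Literature.NumberTheory.GaloisRepresentations
open Summit.BirchSwinnertonDyer.Rank1Residual.Additive hiding EtaSignedSelmerDualData

namespace Summit.BirchSwinnertonDyer.BirchSwinnertonDyer.Theorems

namespace ColemanKatoTorsion

/-! ## §1 Thm. 1.2 from the `η = 1` package and Kato Thm. 13.4 under (v) only -/

section Package

variable {p : ℕ} [Fact p.Prime] {V : WeierstrassCurve ℚ} [V.IsElliptic]
  [ContinuousSMul ℤ_[p] (V.tateModule p)] [Module.Free ℤ_[p] (V.tateModule p)]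
  [Module.Finite ℤ_[p] (V.tateModule p)]
  {N : ℕ} {f : CuspForm (Gamma0 N) 2} {ϖ : ℚ} {κ : ZpExtension ℚ p} {γ : absoluteGaloisGroup ℚ}
  {ε : ℤˣ} {I : Kato2004.IwasawaH1Data V p κ γ}

/-- **Kobayashi Thm. 1.2 (= Thm. 7.3 ii)) IN THE KERNEL from the `η = 1` Coleman/Kato package and Kato
Thm. 13.4, under Kato's hypothesis (v) ONLY.** Frame: `K : SignedColemanKatoData V p f ϖ κ γ ε I`
(injective `col`, `Z ≤ span{Euler-system classes}`, Thm. 6.3 on ideals, (7.21) for every dual datum), `p`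
odd, `(κ, γ)` cyclotomic, `V[p]` irreducible (for the image clause), (v) for `T_pV`, a non-zero Pollack
`L_p^ε` and a `p`-adic unit period ratio. Conclusion: EVERY dual datum `D` of `Sel^ε(V/ℚ_∞)` has `D.X`
finitely generated AND `Λ`-torsion. Proof: the non-zero Euler-system class `e` of g3's
`exists_isEulerSystemClass_ne_zero`; `X₀(V/ℚ_∞)` torsion by Thm. 13.4 (2) at `(T)`
(`Kato2004.isTorsion_fineSelmerDual_of_thm13_4_of_injective` with `c := col`, `col e ≠ 0`); (7.21) gives
finite generation and, as `0 → 𝐇¹/Λe → Λ/(col e) → X^ε → X₀ → 0`, torsion. CONDITIONAL on `h134` and on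
the existence of `K`. [cite: Kobayashi2003, Thm. 7.3 i)–ii), (7.21) and Cor. 7.2 (p. 13), Thm. 1.2 (p. 2)]
[cite: Kato2004Asterisque, Thm. 13.4 (2) (p. 226)] -/
theorem finite_isTorsion_of_colemanKato_of_thm13_4_of_conditionV
    (K : Kobayashi2003.SignedColemanKatoData V p f ϖ κ γ ε I)
    (h134 : Kato2004.thm13_4_lengthAt_fineSelmerDual_le_of_isEulerSystemClass)
    (hp2 : p ≠ 2) (hκ : κ.IsCyclotomic) (hγ : κ.IsTopGenerator γ)
    (hirr : V.HasIrreducibleModPGaloisRep p)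
    (hv : ∃ σ : absoluteGaloisGroup ℚ,
      (∀ (n : ℕ) (t : AlgebraicClosure ℚ), t ^ p ^ n = 1 → σ • t = t) ∧
        Module.finrank ℤ_[p] ((V.tateModule p) ⧸ LinearMap.range (V.galoisRepTate p σ - 1)) = 1)
    {L : IwasawaAlgebra p} (hL : Kobayashi2003.IsSignedPAdicLFunction f p ε L) (hL0 : L ≠ 0)
    (u : ℤ_[p]ˣ) (hu : ((u : ℤ_[p]) : ℚ_[p]) = ((ϖ : ℚ) : ℚ_[p]))
    (D : Kobayashi2003.SignedSelmerDualData V κ γ ε) :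
    Module.Finite (IwasawaAlgebra p) D.X ∧ Module.IsTorsion (IwasawaAlgebra p) D.X := by
  haveI : Module.Finite (IwasawaAlgebra p) I.H :=
    Kato2004.IwasawaH1Data.module_finite_of_isCyclotomic hκ hγ I
  obtain ⟨Y⟩ := V.nonempty_fineSelmerDualData κ hγ
  haveI : Module.Finite (IwasawaAlgebra p) Y.X :=
    WeierstrassCurve.FineSelmerDualData.module_finite _ κ hγ Y
  -- the non-zero Euler-system class and `X₀(V/ℚ_∞)` torsion by Thm. 13.4 (2) at `(T)`
  obtain ⟨e, he, he0⟩ := exists_isEulerSystemClass_ne_zero K hirr hL hL0 u hu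
  have hce0 : K.col e ≠ 0 := fun h ↦ he0 (K.col_injective (by rw [h, map_zero]))
  have hYtor : Module.IsTorsion (IwasawaAlgebra p) Y.X :=
    Kato2004.isTorsion_fineSelmerDual_of_thm13_4_of_injective h134 hp2 hκ hγ I Y he hv K.col
      K.col_injective hce0
  -- (7.21) for `D`
  obtain ⟨j, k, hcj, hjk, hk⟩ := K.exact D Y
  refine ⟨Module.Finite.of_exact hjk hk, ?_⟩
  obtain ⟨i, j', k', -, -, hjk', -⟩ :=
    Thm74Skeleton.exists_fourTermExact_of_threeTermExact K.col j k K.col_injective hcj hjk hk e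
  exact Thm74Skeleton.isTorsion_of_exact (Thm74Skeleton.isTorsion_quotient_span_singleton hce0) hYtor
    j' k' hjk'

end Package

/-! ## §2 Thm. 1.2 on every NON-CM row from `{hCK, h134, h5}` -/

section NonCM

variable {p : ℕ} [Fact p.Prime]

/-- **Kobayashi Thm. 1.2 on every NON-CM row, from three named facts by name** — `hCK` (the `η = 1`
Coleman/Kato package), `h134` (Kato Thm. 13.4), `h5` (period unit): for `V/ℚ` globally minimal WITHOUT
complex multiplication, `p ≥ 5` good with `a_p = 0` (hence supersingular, `V[p]` irreducible by Serre 1972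
§1.11), a newform `f` of `V`, the cyclotomic `(κ, γ)` matching the variable, EVERY sign `ε` and EVERY dual
datum `D` of `Sel^ε(V/ℚ_∞)`: `D.X` is finitely generated `Λ`-torsion. Kato's (v) for `T_pV` is the tree
theorem `Kato2004.exists_finrank_coker_eq_one_of_not_hasCM`; the rest as in g3's tower-onto version,
which this contains (a tower-onto curve is non-CM). CONDITIONAL on `{hCK, h134, h5}`; closes nothing.
[cite: Kobayashi2003, Thm. 1.2 (p. 2), Thm. 7.3 ii) (p. 13)] [cite: Kato2004Asterisque, Thm. 13.4 (2) and the remark after 13.4 (p. 226)]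
[cite: Serre1972, §1.11 Prop. 12] [cite: GreenbergVatsal2000, §3, Remark 3.4] -/
theorem finite_isTorsion_signedSelmerDual_of_colemanKato_nonCM
    (hCK : Kobayashi2003.thm62_63_73_signedColemanKato_zeta)
    (h134 : Kato2004.thm13_4_lengthAt_fineSelmerDual_le_of_isEulerSystemClass)
    (h5 : realPeriodRat_eq_unit_mul_plusPeriod)
    (V : WeierstrassCurve ℚ) [V.IsElliptic] [V.IsGloballyMinimal] (hV : ¬ V.HasCM) (hp5 : 5 ≤ p)
    (hgood : V.HasGoodReductionAtPrime p) (hap : V.frobeniusTrace p = 0)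
    {N : ℕ} [NeZero N] {f : CuspForm (Gamma0 N) 2} (hf : IsNewformOf V f)
    (κ : ZpExtension ℚ p) (γ : absoluteGaloisGroup ℚ) (hκ : κ.IsCyclotomic) (hγ : κ.IsTopGenerator γ)
    (hγc : IsCyclotomicVariable p γ) (ε : ℤˣ) (D : Kobayashi2003.SignedSelmerDualData V κ γ ε) :
    Module.Finite (IwasawaAlgebra p) D.X ∧ Module.IsTorsion (IwasawaAlgebra p) D.X := by
  have hp : p.Prime := Fact.out
  have hp2 : p ≠ 2 := by omega
  haveI : ContinuousSMul ℤ_[p] (V.tateModule p) := TateModule.continuousSMul_padicInt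
  haveI : Module.Free ℤ_[p] (V.tateModule p) := V.module_free_tateModule_holds p
  haveI : Module.Finite ℤ_[p] (V.tateModule p) := V.module_finite_tateModule_holds p
  haveI : NeZero ((p : ℕ) : ℚ) := ⟨Nat.cast_ne_zero.mpr hp.ne_zero⟩
  -- `V[p]` irreducible at a good supersingular odd prime (Serre)
  have hirr : V.HasIrreducibleModPGaloisRep p :=
    hasIrreducibleModPGaloisRep_of_dvd_frobeniusTrace V p hp2
      (V.not_dvd_minimalDiscriminantInt_of_hasGoodReductionAtPrime' p hgood) (by rw [hap]; exact dvd_zero _)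
  -- the period ratio `ϖ = u⁻¹` is a `p`-adic unit
  obtain ⟨u₀, hu₀, hΩ⟩ := h5 V p hp5 hgood hirr f hf
  have hu₀0 : u₀ ≠ 0 := by
    rintro rfl
    simp at hu₀
  have hϖ : ((u₀⁻¹ : ℚ) : ℝ) * V.realPeriodRat = plusPeriod f := by
    rw [hΩ, Rat.cast_inv, ← mul_assoc, inv_mul_cancel₀ (Rat.cast_ne_zero.mpr hu₀0), one_mul]
  have hvϖ : padicValRat p (u₀⁻¹ : ℚ) = 0 :=
    Rank1Residual.padicValRat_periodRatio_eq_zero_of_five_le h5 V p hp5 hgood hirr f hf _ hϖ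
  obtain ⟨u, hu⟩ :=
    Summit.BirchSwinnertonDyer.Rank1Residual.Supersingular.exists_units_coe_eq_ratCast
      (inv_ne_zero hu₀0) hvϖ
  -- the package, Pollack's non-zero `L_p^ε`, Kato's (v) for the non-CM `V`
  obtain ⟨I⟩ := Kato2004.nonempty_iwasawaH1Data_holds V p κ γ hκ hγ
  obtain ⟨K⟩ := hCK V p f (u₀⁻¹ : ℚ) κ γ hp2 hgood hap hf hϖ hκ hγ hγc ε I
  obtain ⟨L, hL0, hL⟩ := Kobayashi2003.exists_isSignedPAdicLFunction
    (pollack_exists_plusMinusPAdicLFunction_holds (W := V) (f := f) (p := p)) hp2 hf hgood hap ε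
  exact finite_isTorsion_of_colemanKato_of_thm13_4_of_conditionV K h134 hp2 hκ hγ hirr
    (Kato2004.exists_finrank_coker_eq_one_of_not_hasCM V hV p) hL hL0 u hu D

end NonCM

/-! ## §3 (RK⁺) on every non-CM row from `{hZ, hCK, h134, h5}`; the aside decl on non-CM rows; the
crux decl -/

section RK

variable {p : ℕ} [Fact p.Prime]

/-- **(RK⁺) `QuadraticBranchPlusKatoDivisibilityAt V p` on every NON-CM Gss2 row from the four named
CONSTRUCTION-level facts** `{hZ, hCK, h134, h5}` — g3's `quadraticBranchPlusKatoDivisibilityAt_of_zeta_of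
_thm13_4_of_row` fed with Kato's (v) for `V^{(p*)}` (`Kato2004.exists_finrank_coker_eq_one_quadraticTwist
_primeStar_of_not_hasCM`, g5) and Thm. 1.2 on the row (§2). No Kobayashi theorem (1.2 / 2.2 / 4.1 /
Cor. 7.2) is a hypothesis. CONDITIONAL on the four named facts; closes nothing.
[cite: Kobayashi2003, Thm. 4.1 (p. 8), Thm. 2.2 (p. 5), Thm. 1.2 (p. 2)] [cite: Kato2004Asterisque, Thm. 13.4 (p. 226)]
[cite: GreenbergVatsal2000, §3, Remark 3.4] -/
theorem quadraticBranchPlusKatoDivisibilityAt_of_colemanPackages_of_not_hasCM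
    (hZ : Kobayashi2003.thm62_63_73_etaColemanPoitouTate_zeta)
    (hCK : Kobayashi2003.thm62_63_73_signedColemanKato_zeta)
    (h134 : Kato2004.thm13_4_lengthAt_fineSelmerDual_le_of_isEulerSystemClass)
    (h5 : realPeriodRat_eq_unit_mul_plusPeriod)
    (V : WeierstrassCurve ℚ) [V.IsElliptic] [V.IsGloballyMinimal] (hV : ¬ V.HasCM) (hp5 : 5 ≤ p)
    (hgood : V.HasGoodReductionAtPrime p) (hap : V.frobeniusTrace p = 0) :
    QuadraticBranchPlusKatoDivisibilityAt V p := by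
  have hp2 : p ≠ 2 := by omega
  exact quadraticBranchPlusKatoDivisibilityAt_of_zeta_of_thm13_4_of_row hZ h134 V hp5 hgood hap
    (fun {_} => Kato2004.exists_finrank_coker_eq_one_quadraticTwist_primeStar_of_not_hasCM hp2 V hV)
    fun κ γ hκ hγ hγc _ _ _ hf D =>
      finite_isTorsion_signedSelmerDual_of_colemanKato_nonCM hCK h134 h5 V hV hp5 hgood hap hf κ γ hκ
        hγ hγc 1 D

/-- **The aside decl `PlusKatoDivisibilityBranch` (item 21377 = the statement of the moot item 19241)
RESTRICTED TO THE NON-CM ROWS, from `{hZ, hCK, h134, h5}`** — the successor of g5's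
`KatoSideNonCM.plusKatoDivisibilityBranch_nonCM_of_facts` (`{hZ, h134, h12}`) with Kobayashi Thm. 1.2
replaced by the `η = 1` package and the period unit. CONDITIONAL; the CM rows are NOT claimed (Kato (v)
fails there). [cite: Kobayashi2003, Thm. 4.1 (p. 8)] [cite: Kato2004Asterisque, Thm. 13.4 and the remark after it (p. 226)] -/
theorem plusKatoDivisibilityBranch_nonCM_of_colemanPackages
    (hZ : Kobayashi2003.thm62_63_73_etaColemanPoitouTate_zeta)
    (hCK : Kobayashi2003.thm62_63_73_signedColemanKato_zeta)
    (h134 : Kato2004.thm13_4_lengthAt_fineSelmerDual_le_of_isEulerSystemClass)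
    (h5 : realPeriodRat_eq_unit_mul_plusPeriod) :
    ∀ (V : WeierstrassCurve ℚ) [V.IsElliptic] [V.IsGloballyMinimal] (p : ℕ) [Fact p.Prime], ¬ V.HasCM →
      5 ≤ p → V.HasGoodReductionAtPrime p → V.frobeniusTrace p = 0 →
      QuadraticBranchPlusKatoDivisibilityAt V p :=
  fun V _ _ _ _ hV hp5 hgood hap =>
    quadraticBranchPlusKatoDivisibilityAt_of_colemanPackages_of_not_hasCM hZ hCK h134 h5 V hV hp5 hgood hap

/-- **The crux decl `PlusKatoDivisibilityBranchOnto` (item 20445) BY NAME from `{hZ, hCK, h134, h5}`,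
through the non-CM road** (a tower-onto `V` has no CM: `KatoSideCM.not_hasCM_of_forall_hasSurjective
ModNGaloisRep`, g6) — a one-line check that §3 specialises to the crux (g3's
`plusKatoDivisibilityBranch_onto_of_colemanPackages` is the same statement by the (12.5.2) road).
CONDITIONAL on the four named facts; the item stays settled-by-citation on `{hZ, h134, h12}`.
[cite: Kobayashi2003, Thm. 4.1 (p. 8)] [cite: Kato2004Asterisque, Thm. 13.4 (p. 226)] -/
theorem plusKatoDivisibilityBranchOnto_of_colemanPackages_via_nonCM
    (hZ : Kobayashi2003.thm62_63_73_etaColemanPoitouTate_zeta)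
    (hCK : Kobayashi2003.thm62_63_73_signedColemanKato_zeta)
    (h134 : Kato2004.thm13_4_lengthAt_fineSelmerDual_le_of_isEulerSystemClass)
    (h5 : realPeriodRat_eq_unit_mul_plusPeriod) :
    Theses.QuadraticBranchSignedControl.PlusKatoDivisibilityBranchOnto := by
  intro V _ _ p _ hp5 hgood hap hsurj
  have hp2 : p ≠ 2 := by omega
  exact quadraticBranchPlusKatoDivisibilityAt_of_colemanPackages_of_not_hasCM hZ hCK h134 h5 V
    (KatoSideCM.not_hasCM_of_forall_hasSurjectiveModNGaloisRep hp2 V hsurj) hp5 hgood hap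

end RK

end ColemanKatoTorsion

end Summit.BirchSwinnertonDyer.BirchSwinnertonDyer.Theorems

end
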